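import Summits.Ventures.LatticeQCDFlow.Exactness.Phi4MetropolisMagnetisationMomentCSD
import Summits.Ventures.LatticeQCDFlow.Exactness.FreeFieldHMCZeroMode
import HarnessLib

/-!
# The local arm on the free field: `τ_int,sweep(M) ≥ ξ²/m₂ − ½` — `z = 2` with the constant, for every even step law

HONEST FRAMING: exact (Metropolis-corrected) sampling algorithms for lattice gauge theory;
figures of merit are autocorrelation/cost numbers at stated couplings and volumes; no
continuum-physics claim.  (SCALAR calibration rung S0-A: not a gauge result.)

Venture `LatticeQCDFlow` (cell pub-lqcd), topic `Exactness`; FANOUT row 2 (`s0-phi4`, LOCAL arm: the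
dynamical exponent `z` of the magnetisation).  NEW WORK of the cell, the companion of
`FreeFieldHMCMagnetisationCSD` (HMC arm, `τ_int,traj(M) ≥ ξ²/T² − ½`): gen-14's floor
`Phi4MetropolisMagnetisationMomentCSD.metropolisScan_tauInt_sweep_ge_magnetisation_of_moments`
(`τ_int,sweep(M) ≥ 2χ/m₂ − ½`, `λ > 0`) is re-run under COERCIVITY, so that the Gaussian free field
(`λ = 0`, `m² > 0`) is covered, and evaluated with the free-field susceptibility
`χ = Var(M)/V = 1/(2m²)` of `FreeFieldHMCZeroMode` (`free_totalField_sq`, `free_totalField_mean`).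
Nothing is cited as a fact.  Printed counterparts, NAMED ONLY: the diffusive law `z = 2` of local
Metropolis / heat-bath dynamics on the Gaussian model (e.g. Sokal's 1989/1996 lectures), Caracciolo–
Pelissetto–Sokal 1994 (displacement floors).

Setting: `S = Σ_x [Σ_μ (φ(σ_μ x) − φ_x)² + m² φ_x²]` on `V = n + 1` sites (`J = shiftCoupling σ m²`,
`λ = 0`), the random-site-scan Metropolis operator `metroScan J 0 ρ` with an even step density `ρ`
(`∫ρ = 1`, all moments `∫(1+|u|)^j ρ < ∞`; second moment `m₂ = ∫ u² ρ`), a SWEEP = `V` proposals,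
`M = Σ_x φ_x`, `g = M − ⟨M⟩`, `ρ_g(k) = ∫ g (Kᵏ g) e^{−S}/∫ g² e^{−S}`, `ξ² = 1/m²`.

## What is proved

* **`metropolisScan_tauInt_sweep_ge_magnetisation_of_coercive`** — the floor
  `τ_int,sweep(M) ≥ 2 Var(M)/(V m₂) − ½` for every coercive action `εΣφ² − K ≤ S` (any real `λ`,
  `J`), every even step law with moments, summable sweep-thinned autocorrelations with `ρ_g(V) < 1`
  (gen-14's proof verbatim, `λ > 0` replaced by coercivity).
* **`freeMetropolis_tauInt_sweep_ge_magnetisation`** — THE FREE FIELD: every `m² > 0`, every volume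
  and shift structure, every such step law: `τ_int,sweep(M) ≥ 1/(m² m₂) − ½ = ξ²/m₂ − ½`;
  **`freeMetropolis_tauInt_sweep_ge_magnetisation_gaussian`** — Gaussian steps `N(0, v)`:
  `τ_int,sweep(M) ≥ ξ²/v − ½`; **`freeMetropolis_tauInt_sweep_ge_magnetisation_window`** — any
  step law supported in `[−δ, δ]` (the engine's window): `τ_int,sweep(M) ≥ ξ²/δ² − ½` (`m₂ ≤ δ²`).

Reading for S0-A (no numerics implied; free field, where `ξ = 1/m` exactly): the random-scan local arm
needs at least `ξ²/m₂` sweeps per independent magnetisation — `z_M ≥ 2` with the constant `1/m₂` — and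
the Metropolis-corrected HMC arm at fixed trajectory length `T` needs at least `ξ²/T²` trajectories
(`FreeFieldHMCMagnetisationCSD`); in units of site updates (a sweep = `V`, a trajectory of `N` force
sweeps = `N·V`) the two floors read `ξ²/m₂` and `ξ²/(N δ²)`: per unit of work the magnetisation moves
in mean square by at most the squared step, for both arms.  NOT CLAIMED: `ρ_g(V) < 1` / summability for
any run (hypotheses); the ordered sweep; `λ > 0` (there `χ` is a measured column: gen-14's file).
-/

namespace Summit.Ventures.LatticeQCDFlow.Exactness

open Real MeasureTheory Filter Finset ProbabilityTheory
open Summit.Ventures.LatticeQCDFlow.Scoring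

section Local

variable {n : ℕ}

/-- **THE LOCAL-ARM MAGNETISATION FLOOR, COERCIVE FORM**: `εΣφ² − K ≤ S` (`ε > 0`, any real `λ`,
`J`), `ρ ≥ 0` measurable even with `∫ρ = 1` and all moments, `g = M − ⟨M⟩` with summable
sweep-thinned autocorrelations and `ρ_g(n+1) < 1` ⇒ `τ_int,sweep(M) ≥ 2 Var(M)/((n+1) m₂) − ½`. -/
theorem metropolisScan_tauInt_sweep_ge_magnetisation_of_coercive {J : Fin (n + 1) → Fin (n + 1) → ℝ}
    {lam ε K : ℝ} (hε : 0 < ε)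
    (hS : ∀ φ : Fin (n + 1) → ℝ, ε * ∑ w, φ w ^ 2 - K ≤ latticePhi4Action J lam φ)
    {ρ : ℝ → ℝ} (hρ0 : ∀ u, 0 ≤ ρ u) (hρm : Measurable ρ)
    (hρi : Integrable ρ) (hρ1 : ∫ u, ρ u = 1) (hρs : ∀ u, ρ (-u) = ρ u)
    (hρmom : ∀ j : ℕ, Integrable (fun u => (1 + |u|) ^ j * ρ u))
    (hs : Summable fun k => (∫ φ, ((∑ y, φ y) - gibbsExpect J lam (fun ψ => ∑ y, ψ y))
        * ((metroScan J lam ρ)^[(n + 1) * (k + 1)]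
            (fun ψ => (∑ y, ψ y) - gibbsExpect J lam (fun ψ => ∑ y, ψ y))) φ * gibbsWeight J lam φ)
        / ∫ φ, ((∑ y, φ y) - gibbsExpect J lam (fun ψ => ∑ y, ψ y)) ^ 2 * gibbsWeight J lam φ)
    (hρV : (∫ φ, ((∑ y, φ y) - gibbsExpect J lam (fun ψ => ∑ y, ψ y))
        * ((metroScan J lam ρ)^[n + 1]
            (fun ψ => (∑ y, ψ y) - gibbsExpect J lam (fun ψ => ∑ y, ψ y))) φ * gibbsWeight J lam φ)
        / (∫ φ, ((∑ y, φ y) - gibbsExpect J lam (fun ψ => ∑ y, ψ y)) ^ 2 * gibbsWeight J lam φ)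
        < 1) :
    2 * gibbsExpect J lam (fun φ => ((∑ y, φ y) - gibbsExpect J lam (fun ψ => ∑ y, ψ y)) ^ 2)
        / ((n + 1) * ∫ u, u ^ 2 * ρ u) - 1 / 2
      ≤ tauInt (fun k => (∫ φ, ((∑ y, φ y) - gibbsExpect J lam (fun ψ => ∑ y, ψ y))
        * ((metroScan J lam ρ)^[(n + 1) * k]
            (fun ψ => (∑ y, ψ y) - gibbsExpect J lam (fun ψ => ∑ y, ψ y))) φ * gibbsWeight J lam φ)
        / ∫ φ, ((∑ y, φ y) - gibbsExpect J lam (fun ψ => ∑ y, ψ y)) ^ 2 * gibbsWeight J lam φ) := by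
  have hρ2 := integrable_sq_mul_of_moments hρ0 hρm hρmom
  set c := gibbsExpect J lam (fun ψ : Fin (n + 1) → ℝ => ∑ y, ψ y) with hc
  have hg : PolyObs (fun ψ : Fin (n + 1) → ℝ => (∑ y, ψ y) - c) := polyObs_magnetisation_sub c
  have hg2 : PolyObs (fun ψ : Fin (n + 1) → ℝ => ((∑ y, ψ y) - c) ^ 2) := polyObs_sq hg
  have hglip : ∀ (φ : Fin (n + 1) → ℝ) (x : Fin (n + 1)) (t' : ℝ),
      |((∑ y, Function.update φ x t' y) - c) - ((∑ y, φ y) - c)| ≤ |t' - φ x| := by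
    intro φ x t'
    rw [show ((∑ y, Function.update φ x t' y) - c) - ((∑ y, φ y) - c) = t' - φ x by
      rw [← sum_update_sub_sum φ x t']; ring]
  have hΓ : ∀ φ, metroScan J lam ρ (fun ψ => (((∑ y, ψ y) - c) - ((∑ y, φ y) - c)) ^ 2) φ
      ≤ ∫ u, u ^ 2 * ρ u := fun φ => metroScan_sq_dev_le_moment J lam hρ0 hρ2 φ (hglip φ)
  have hfloor := RevOp.thinned_tauInt_ge_of_carre_le (μ := volume) (A := PolyObs)
    (K := metroScan J lam ρ) (w := gibbsWeight J lam)
    (fun φ => (gibbsWeight_pos J lam φ).le) (polyObs_const 1)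
    (fun f h hf hh => polyObs_integrable_mul_mul_gibbsWeight hε hS hf hh)
    (fun f h c hf hh => polyObs_add_mul hf hh c)
    (fun f hf => polyObs_metroScan J lam hρ0 hρm hρmom hf)
    (fun f h c hf hh x => metroScan_add_mul_poly J lam hρ0 hρm hρmom hf hh c x)
    (fun f h hf hh => metroScan_reversible_poly hε hS hρ0 hρm hρi hρ1 hρs hρmom hf hh)
    (fun f hf => metroScan_contraction_poly hε hS hρ0 hρm hρi hρ1 hρs hρmom hf)
    (fun φ => metroScan_one J lam hρ1 φ) hg hg2 hΓ (show 0 < n + 1 by omega) hs hρV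
  have e : ∀ P Z D : ℝ, 2 * (P / Z) / (((n : ℝ) + 1) * D) - 1 / 2
      = 2 * P / (((n + 1 : ℕ) : ℝ) * D * Z) - 1 / 2 := by
    intro P Z D
    push_cast
    rw [← mul_div_assoc, div_div, mul_comm Z]
  exact (e _ _ _).le.trans hfloor

end Local

/-! ## The free field -/

section Free

variable {n : ℕ} {ι : Type*} [Fintype ι]

/-- **THE LOCAL ARM ON THE FREE FIELD: `τ_int,sweep(M) ≥ ξ²/m₂ − ½`.**  Every `m² > 0`, every volume and
shift structure, every even step density `ρ` with `∫ρ = 1` and all moments (`m₂ = ∫ u² ρ`);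
`g = M − ⟨M⟩` with summable sweep-thinned autocorrelations and `ρ_g(n+1) < 1` under the random-site
scan `metroScan (shiftCoupling σ m²) 0 ρ` ⇒ `τ_int,sweep(M) ≥ 1/(m² m₂) − ½`. -/
theorem freeMetropolis_tauInt_sweep_ge_magnetisation (σ : ι → Equiv.Perm (Fin (n + 1))) {m2 : ℝ}
    (hm : 0 < m2) {ρ : ℝ → ℝ} (hρ0 : ∀ u, 0 ≤ ρ u) (hρm : Measurable ρ)
    (hρi : Integrable ρ) (hρ1 : ∫ u, ρ u = 1) (hρs : ∀ u, ρ (-u) = ρ u)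
    (hρmom : ∀ j : ℕ, Integrable (fun u => (1 + |u|) ^ j * ρ u))
    (hs : Summable fun k => (∫ φ, ((∑ y, φ y) - gibbsExpect (shiftCoupling σ m2) 0 (fun ψ => ∑ y, ψ y))
        * ((metroScan (shiftCoupling σ m2) 0 ρ)^[(n + 1) * (k + 1)]
            (fun ψ => (∑ y, ψ y) - gibbsExpect (shiftCoupling σ m2) 0 (fun ψ => ∑ y, ψ y))) φ
        * gibbsWeight (shiftCoupling σ m2) 0 φ)
        / ∫ φ, ((∑ y, φ y) - gibbsExpect (shiftCoupling σ m2) 0 (fun ψ => ∑ y, ψ y)) ^ 2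
          * gibbsWeight (shiftCoupling σ m2) 0 φ)
    (hρV : (∫ φ, ((∑ y, φ y) - gibbsExpect (shiftCoupling σ m2) 0 (fun ψ => ∑ y, ψ y))
        * ((metroScan (shiftCoupling σ m2) 0 ρ)^[n + 1]
            (fun ψ => (∑ y, ψ y) - gibbsExpect (shiftCoupling σ m2) 0 (fun ψ => ∑ y, ψ y))) φ
        * gibbsWeight (shiftCoupling σ m2) 0 φ)
        / (∫ φ, ((∑ y, φ y) - gibbsExpect (shiftCoupling σ m2) 0 (fun ψ => ∑ y, ψ y)) ^ 2
          * gibbsWeight (shiftCoupling σ m2) 0 φ) < 1) :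
    1 / (m2 * ∫ u, u ^ 2 * ρ u) - 1 / 2
      ≤ tauInt (fun k => (∫ φ, ((∑ y, φ y) - gibbsExpect (shiftCoupling σ m2) 0 (fun ψ => ∑ y, ψ y))
        * ((metroScan (shiftCoupling σ m2) 0 ρ)^[(n + 1) * k]
            (fun ψ => (∑ y, ψ y) - gibbsExpect (shiftCoupling σ m2) 0 (fun ψ => ∑ y, ψ y))) φ
        * gibbsWeight (shiftCoupling σ m2) 0 φ)
        / ∫ φ, ((∑ y, φ y) - gibbsExpect (shiftCoupling σ m2) 0 (fun ψ => ∑ y, ψ y)) ^ 2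
          * gibbsWeight (shiftCoupling σ m2) 0 φ) := by
  have h := metropolisScan_tauInt_sweep_ge_magnetisation_of_coercive hm (free_coercive σ m2)
    hρ0 hρm hρi hρ1 hρs hρmom hs hρV
  have hvar : gibbsExpect (shiftCoupling σ m2) 0 (fun φ =>
      ((∑ y, φ y) - gibbsExpect (shiftCoupling σ m2) 0 (fun ψ => ∑ y, ψ y)) ^ 2)
      = ((n : ℝ) + 1) / (2 * m2) := by
    simp only [free_totalField_mean σ hm, sub_zero]
    exact free_totalField_sq σ hm
  rw [hvar] at h
  -- the second moment is non-negative; if it vanishes both sides degenerate harmlessly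
  have hm2 : 0 ≤ ∫ u, u ^ 2 * ρ u := integral_nonneg fun u => mul_nonneg (sq_nonneg u) (hρ0 u)
  have hV : (0 : ℝ) < (n : ℝ) + 1 := by positivity
  rcases hm2.lt_or_eq with hpos | hzero
  · have e : 2 * (((n : ℝ) + 1) / (2 * m2)) / (((n : ℝ) + 1) * ∫ u, u ^ 2 * ρ u)
        = 1 / (m2 * ∫ u, u ^ 2 * ρ u) := by
      field_simp
    rw [e] at h
    exact h
  · rw [← hzero, mul_zero] at h ⊢
    simpa using h

/-- **Gaussian steps `u ∼ N(0, v)`** (`v ≠ 0`), free field: `τ_int,sweep(M) ≥ ξ²/v − ½ = 1/(m² v) − ½`. -/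
theorem freeMetropolis_tauInt_sweep_ge_magnetisation_gaussian (σ : ι → Equiv.Perm (Fin (n + 1)))
    {m2 : ℝ} (hm : 0 < m2) {v : NNReal} (hv : v ≠ 0)
    (hs : Summable fun k => (∫ φ, ((∑ y, φ y) - gibbsExpect (shiftCoupling σ m2) 0 (fun ψ => ∑ y, ψ y))
        * ((metroScan (shiftCoupling σ m2) 0 (gaussianPDFReal 0 v))^[(n + 1) * (k + 1)]
            (fun ψ => (∑ y, ψ y) - gibbsExpect (shiftCoupling σ m2) 0 (fun ψ => ∑ y, ψ y))) φ
        * gibbsWeight (shiftCoupling σ m2) 0 φ)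
        / ∫ φ, ((∑ y, φ y) - gibbsExpect (shiftCoupling σ m2) 0 (fun ψ => ∑ y, ψ y)) ^ 2
          * gibbsWeight (shiftCoupling σ m2) 0 φ)
    (hρV : (∫ φ, ((∑ y, φ y) - gibbsExpect (shiftCoupling σ m2) 0 (fun ψ => ∑ y, ψ y))
        * ((metroScan (shiftCoupling σ m2) 0 (gaussianPDFReal 0 v))^[n + 1]
            (fun ψ => (∑ y, ψ y) - gibbsExpect (shiftCoupling σ m2) 0 (fun ψ => ∑ y, ψ y))) φ
        * gibbsWeight (shiftCoupling σ m2) 0 φ)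
        / (∫ φ, ((∑ y, φ y) - gibbsExpect (shiftCoupling σ m2) 0 (fun ψ => ∑ y, ψ y)) ^ 2
          * gibbsWeight (shiftCoupling σ m2) 0 φ) < 1) :
    1 / (m2 * (v : ℝ)) - 1 / 2
      ≤ tauInt (fun k => (∫ φ, ((∑ y, φ y) - gibbsExpect (shiftCoupling σ m2) 0 (fun ψ => ∑ y, ψ y))
        * ((metroScan (shiftCoupling σ m2) 0 (gaussianPDFReal 0 v))^[(n + 1) * k]
            (fun ψ => (∑ y, ψ y) - gibbsExpect (shiftCoupling σ m2) 0 (fun ψ => ∑ y, ψ y))) φ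
        * gibbsWeight (shiftCoupling σ m2) 0 φ)
        / ∫ φ, ((∑ y, φ y) - gibbsExpect (shiftCoupling σ m2) 0 (fun ψ => ∑ y, ψ y)) ^ 2
          * gibbsWeight (shiftCoupling σ m2) 0 φ) := by
  have h := freeMetropolis_tauInt_sweep_ge_magnetisation σ hm
    (fun u => gaussianPDFReal_nonneg 0 v u) (measurable_gaussianPDFReal 0 v)
    (integrable_gaussianPDFReal 0 v) (integral_gaussianPDFReal_eq_one 0 hv)
    (gaussianPDFReal_zero_neg v) (gaussianPDFReal_moments hv) hs hρV
  rw [integral_sq_mul_gaussianPDFReal hv] at h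
  exact h

/-- For a step density supported in `[−δ, δ]`: `m₂ = ∫ u² ρ ≤ δ²`. -/
theorem secondMoment_le_of_window {ρ : ℝ → ℝ} (hρ0 : ∀ u, 0 ≤ ρ u) (hρi : Integrable ρ)
    (hρ1 : ∫ u, ρ u = 1) {δ : ℝ} (hρδ : ∀ u, δ < |u| → ρ u = 0)
    (hρ2 : Integrable (fun u => u ^ 2 * ρ u)) :
    ∫ u, u ^ 2 * ρ u ≤ δ ^ 2 := by
  have hpt : ∀ u, u ^ 2 * ρ u ≤ δ ^ 2 * ρ u := by
    intro u
    by_cases hz : ρ u = 0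
    · simp [hz]
    · have hle : |u| ≤ δ := le_of_not_gt fun h => hz (hρδ u h)
      have : u ^ 2 ≤ δ ^ 2 := by
        rw [← sq_abs u]
        exact pow_le_pow_left₀ (abs_nonneg u) hle 2
      exact mul_le_mul_of_nonneg_right this (hρ0 u)
  calc ∫ u, u ^ 2 * ρ u ≤ ∫ u, δ ^ 2 * ρ u := integral_mono hρ2 (hρi.const_mul _) hpt
    _ = δ ^ 2 := by rw [integral_const_mul, hρ1, mul_one]

/-- **Window-supported steps** (any even `ρ` with `∫ρ = 1` vanishing outside `[−δ, δ]` — the engine's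
`U[−δ, δ]` included), free field: `τ_int,sweep(M) ≥ ξ²/δ² − ½ = 1/(m² δ²) − ½`. -/
theorem freeMetropolis_tauInt_sweep_ge_magnetisation_window (σ : ι → Equiv.Perm (Fin (n + 1)))
    {m2 : ℝ} (hm : 0 < m2) {ρ : ℝ → ℝ} (hρ0 : ∀ u, 0 ≤ ρ u) (hρm : Measurable ρ)
    (hρi : Integrable ρ) (hρ1 : ∫ u, ρ u = 1) (hρs : ∀ u, ρ (-u) = ρ u)
    {δ : ℝ} (hρδ : ∀ u, δ < |u| → ρ u = 0)
    (hs : Summable fun k => (∫ φ, ((∑ y, φ y) - gibbsExpect (shiftCoupling σ m2) 0 (fun ψ => ∑ y, ψ y))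
        * ((metroScan (shiftCoupling σ m2) 0 ρ)^[(n + 1) * (k + 1)]
            (fun ψ => (∑ y, ψ y) - gibbsExpect (shiftCoupling σ m2) 0 (fun ψ => ∑ y, ψ y))) φ
        * gibbsWeight (shiftCoupling σ m2) 0 φ)
        / ∫ φ, ((∑ y, φ y) - gibbsExpect (shiftCoupling σ m2) 0 (fun ψ => ∑ y, ψ y)) ^ 2
          * gibbsWeight (shiftCoupling σ m2) 0 φ)
    (hρV : (∫ φ, ((∑ y, φ y) - gibbsExpect (shiftCoupling σ m2) 0 (fun ψ => ∑ y, ψ y))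
        * ((metroScan (shiftCoupling σ m2) 0 ρ)^[n + 1]
            (fun ψ => (∑ y, ψ y) - gibbsExpect (shiftCoupling σ m2) 0 (fun ψ => ∑ y, ψ y))) φ
        * gibbsWeight (shiftCoupling σ m2) 0 φ)
        / (∫ φ, ((∑ y, φ y) - gibbsExpect (shiftCoupling σ m2) 0 (fun ψ => ∑ y, ψ y)) ^ 2
          * gibbsWeight (shiftCoupling σ m2) 0 φ) < 1) :
    1 / (m2 * δ ^ 2) - 1 / 2
      ≤ tauInt (fun k => (∫ φ, ((∑ y, φ y) - gibbsExpect (shiftCoupling σ m2) 0 (fun ψ => ∑ y, ψ y))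
        * ((metroScan (shiftCoupling σ m2) 0 ρ)^[(n + 1) * k]
            (fun ψ => (∑ y, ψ y) - gibbsExpect (shiftCoupling σ m2) 0 (fun ψ => ∑ y, ψ y))) φ
        * gibbsWeight (shiftCoupling σ m2) 0 φ)
        / ∫ φ, ((∑ y, φ y) - gibbsExpect (shiftCoupling σ m2) 0 (fun ψ => ∑ y, ψ y)) ^ 2
          * gibbsWeight (shiftCoupling σ m2) 0 φ) := by
  have hρmom := window_moments hρ0 hρm hρi hρδ
  have h := freeMetropolis_tauInt_sweep_ge_magnetisation σ hm hρ0 hρm hρi hρ1 hρs hρmom hs hρV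
  refine le_trans ?_ h
  have hρ2 := integrable_sq_mul_of_moments hρ0 hρm hρmom
  have hm2le := secondMoment_le_of_window hρ0 hρi hρ1 hρδ hρ2
  have hm2 : 0 ≤ ∫ u, u ^ 2 * ρ u := integral_nonneg fun u => mul_nonneg (sq_nonneg u) (hρ0 u)
  refine sub_le_sub_right ?_ _
  rcases hm2.lt_or_eq with hpos | hzero
  · exact one_div_le_one_div_of_le (mul_pos hm hpos) (mul_le_mul_of_nonneg_left hm2le hm.le)
  · -- `m₂ = 0`: the right side is `1/0 = 0`; but then `ρ` is a.e. zero on `u ≠ 0`, impossible with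
    -- `∫ρ = 1` — we only need the inequality, which `1/(m² δ²) ≥ 0 = 1/0`... goes the wrong way;
    -- instead derive a contradiction: `∫ u² ρ = 0` forces `ρ = 0` a.e., so `∫ ρ = 0 ≠ 1`.
    exfalso
    have hae : (fun u => u ^ 2 * ρ u) =ᵐ[volume] 0 :=
      (integral_eq_zero_iff_of_nonneg (fun u => mul_nonneg (sq_nonneg u) (hρ0 u)) hρ2).mp hzero.symm
    have hρae : ρ =ᵐ[volume] 0 := by
      have hnull : (volume : Measure ℝ) {0} = 0 := Real.volume_singleton
      filter_upwards [hae, measure_eq_zero_iff_ae_notMem.mp hnull] with u hu h0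
      have hu0 : u ≠ 0 := fun h => h0 (by rw [h]; exact Set.mem_singleton 0)
      have : u ^ 2 * ρ u = 0 := hu
      rcases mul_eq_zero.mp this with h | h
      · exact absurd (pow_eq_zero_iff two_ne_zero |>.mp h) hu0
      · exact h
    have : ∫ u, ρ u = 0 := by rw [integral_congr_ae hρae]; simp
    rw [hρ1] at this
    exact one_ne_zero this

end Free

end Summit.Ventures.LatticeQCDFlow.Exactness
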